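/-
O(2) `{φ, s, t}` scan: the LIGHT ROWS of the neutral sectors `0⁺`, `0⁻` and of the `1 × 1` charged sectors
`2⁻`, `3`, `4` with corner tables, uniformly on a BOX of external dimensions.
-/
import Literature.MathematicalPhysics.QuantumFieldTheory.O2NeutralDimBox
import Literature.MathematicalPhysics.QuantumFieldTheory.O2NeutralSectorsBoundCells
import Literature.MathematicalPhysics.QuantumFieldTheory.O2ChargedSectorsRules
import Literature.MathematicalPhysics.QuantumFieldTheory.O2ChargeFourRules
import HarnessLib

/-!
# O(2) `{φ, s, t}` scan: light rows of the sectors `0⁺`, `0⁻`, `2⁻`, `3`, `4` on a BOX of external dimensions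

The cell rules of the sector files decide a light row on a half-open cell `Δ ∈ [a, b)` of the exchanged
dimension at ONE triple `D = (Δ_s, Δ_φ, Δ_t)` from entry tables valid for all `Δ ∈ [a, b]`
(`pos0p/pos0m_on_cell_Ico`, `pos0p/pos0m_on_boundCell_Ico`, `pos3/pos2m/pos4_on_cell_Ico`).  The entries
are two-weight evaluations `T(c, d; s_L(D))[𝒫_{Δ+n, j}]` whose only dependence on `D` is the exponent
`s_L(D) = (Δ_k + Δ_j)/2` — plus, for the sectors `3` and `2⁻`, the block parameter `c = (Δ_t − Δ_φ)/2`
resp. `(Δ_t − Δ_s)/2` of the odd head sums, which the rules already take as an INTERVAL `[c₁, c₂]`.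
Cornering the exponent over a box `lo ≤ D ≤ hi` (`O2DimBox.twoWeightEval_mem_Icc_corner_expo`, the box
numbers `dboxLo0p/dboxRad0p/dboxCb0m/dboxRad0m` of `O2NeutralDimBox`) therefore gives every one of these
light-row rules UNIFORMLY on the box, with the same data shape as at a point:

* `pos0p_on_dbox_cell`, `pos0p_on_dbox_boundCell` (sector `0⁺`, sign–radius vertex matrices of the
  head-cell sums of the box numbers);
* `pos0m_on_dbox_cell`, `pos0m_on_dbox_boundCell` (sector `0⁻`, three numbers);
* `pos3_on_dbox_cell`, `pos2m_on_dbox_cell` (odd head sums with the block-parameter interval induced by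
  the box) and `pos4_on_dbox_cell`.

(The `2 × 2` charged sectors `2⁺`, `1` are treated in `O2ChargedLightDimBox`; the bound cells of the
sectors `2⁻`, `3`, `4`, whose point rules exist only with inlined corner tables, are not treated here.)

NON-CLAIMS.  Soundness lemmas only: no table is evaluated, no certificate is checked, nothing is asserted
about the O(2) model; which cells, boxes and index sets a reader uses is its business.
-/

noncomputable section

namespace Literature.MathematicalPhysics.QuantumFieldTheory.O2LightDimBox

open Set Finset Matrix
open Literature.MathematicalPhysics.QuantumFieldTheory.ConformalBootstrap3D
open O2ThreeScalarCrossing O2ThreeScalarSystem O2OPEScanBridge O2ScanObligations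
open O2NeutralSectorsTermwise O2NeutralSectorsHead O2ChargedSectorsTermwise O2NeutralSectorsCells
open O2NeutralSectorsBoundCells O2NeutralSectorsTail O2ChargedSectorsRules O2ChargeFourRules O2DimBox
open O2NeutralDimBox
open Literature.Analysis.ValidatedNumerics.ParametricIntervalPosSemidef (signRadMatrix)

/-- `lo ≤ x ≤ hi ⇒ |x| ≤ max (−lo) hi` (private helper). [folklore] -/
private theorem abs_le_max_of_mem' {x lo hi : ℝ} (h1 : lo ≤ x) (h2 : x ≤ hi) :
    |x| ≤ max (-lo) hi := by
  rw [abs_le]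
  exact ⟨by linarith [le_max_left (-lo) hi], h2.trans (le_max_right _ _)⟩

/-- The shifted cell: `Δ ∈ [a, b] ⇒ Δ + n ∈ [a + n, b + n]`. Bookkeeping.
[cite: HogervorstRychkov2013, §3 eq. (3.9)] -/
theorem add_mem_Icc_shift' {a b Δ : ℝ} (hΔ : Δ ∈ Icc a b) (n : ℕ) :
    Δ + (n : ℝ) ∈ Icc (a + n) (b + n) :=
  ⟨by linarith [hΔ.1], by linarith [hΔ.2]⟩

/-! ## 1. Entry-wise validity of the box numbers of `O2NeutralDimBox` -/

/-- The diagonal box number bounds the diagonal `0⁺` entry from below on (box) × `[E₁, E₂]`.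
[cite: HogervorstRychkov2013, §3 eq. (3.6)] [cite: ChesterEtAl2020, §3.3 (scanning over external dimensions)] -/
theorem dboxLo0p_le (F : ScanFunctional) {lo hi D : Dims} (hD : InDimBox lo hi D) (j : ℕ) {E₁ E₂ E : ℝ}
    (hE : E ∈ Icc E₁ E₂) (i : Fin 3) : dboxLo0p F lo hi j E₁ E₂ i ≤ termMatrix0p F D E j i i := by
  rw [dboxLo0p, termMatrix0p_apply_eq_twoWeightEval]
  exact (twoWeightEval_mem_Icc_corner_expo F _ _ j hE hD _).1

/-- The box radius bounds the modulus of every `0⁺` entry on (box) × `[E₁, E₂]`.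
[cite: HogervorstRychkov2013, §3 eq. (3.6)] [cite: ChesterEtAl2020, §3.3 (scanning over external dimensions)] -/
theorem abs_le_dboxRad0p (F : ScanFunctional) {lo hi D : Dims} (hD : InDimBox lo hi D) (j : ℕ)
    {E₁ E₂ E : ℝ} (hE : E ∈ Icc E₁ E₂) (i k : Fin 3) :
    |termMatrix0p F D E j i k| ≤ dboxRad0p F lo hi j E₁ E₂ i k := by
  rw [dboxRad0p, Matrix.of_apply, termMatrix0p_apply_eq_twoWeightEval]
  have h := twoWeightEval_mem_Icc_corner_expo F (cw0p F i k) (dw0p F i k) j hE hD (lab0p i k)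
  exact abs_le_max_of_mem' h.1 h.2

/-- The box corner number bounds the diagonal `0⁻` entry from below on (box) × `[E₁, E₂]`.
[cite: HogervorstRychkov2013, §3 eq. (3.6)] [cite: ChesterEtAl2020, §3.3 (scanning over external dimensions)] -/
theorem dboxCb0m_le (F : ScanFunctional) {lo hi D : Dims} (hD : InDimBox lo hi D) (j : ℕ) {E₁ E₂ E : ℝ}
    (hE : E ∈ Icc E₁ E₂) (i : Fin 2) : dboxCb0m F lo hi j E₁ E₂ i i ≤ termMatrix0m F D E j i i := by
  rw [dboxCb0m, termMatrix0m_apply_eq_twoWeightEval]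
  exact (twoWeightEval_mem_Icc_corner_expo F _ _ j hE hD _).1

/-- The box radius bounds the modulus of the off-diagonal `0⁻` entry on (box) × `[E₁, E₂]`.
[cite: HogervorstRychkov2013, §3 eq. (3.6)] [cite: ChesterEtAl2020, §3.3 (scanning over external dimensions)] -/
theorem abs_le_dboxRad0m (F : ScanFunctional) {lo hi D : Dims} (hD : InDimBox lo hi D) (j : ℕ)
    {E₁ E₂ E : ℝ} (hE : E ∈ Icc E₁ E₂) :
    |termMatrix0m F D E j 0 1| ≤ dboxRad0m F lo hi j E₁ E₂ := by
  rw [dboxRad0m, dboxCb0m, termMatrix0m_apply_eq_twoWeightEval]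
  have h := twoWeightEval_mem_Icc_corner_expo F (cw0m F 0 1) (dw0m F 0 1) j hE hD (lab0m 0 1)
  exact abs_le_max_of_mem' h.1 h.2

/-! ## 2. Sector `0⁺` light rows on a box of external dimensions -/

/-- **`0⁺` LIGHT ROWS ON A BOX OF EXTERNAL DIMENSIONS** (cell strictly above the unitarity bound): the
eight sign–radius vertex matrices of the head-cell sums of the box numbers `dboxLo0p/dboxRad0p … q.2
(a+n) (b+n)` PSD, tail term matrices PSD at every `D` of the box (e.g. by
`O2NeutralDimBox.termMatrix0p_posSemidef_on_dbox`) ⇒ `Pos0p` at every `D` with `lo ≤ D ≤ hi` and every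
`Δ ∈ [a, b)`. [cite: KosPolandSimmonsduffin2014, §3.3 eq. (3.16), §4 eqs. (4.2)–(4.3)]
[cite: HogervorstRychkov2013, §3 eqs. (3.6), (3.9)] [cite: Hladik2017, Thm. 1 ((2) ⇒ (1))]
[cite: ChesterEtAl2020, §3.3 (scanning over external dimensions)] -/
theorem pos0p_on_dbox_cell (F : ScanFunctional) {lo hi : Dims} {ℓ : ℕ} {a b : ℝ}
    (ha : unitarityBound3D ℓ < a) (S : Finset (ℕ × ℕ))
    (hvert : ∀ z : Fin 3 → Bool, (signRadMatrix
      (fun i => headCellSumI ℓ a b S (fun q => dboxLo0p F lo hi q.2 (a + q.1) (b + q.1) i))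
      (Matrix.of fun i k => headAbsSumI ℓ a b S (fun q => dboxRad0p F lo hi q.2 (a + q.1) (b + q.1) i k))
        z).PosSemidef)
    (htail : ∀ D, InDimBox lo hi D → ∀ q : ℕ × ℕ, q ∉ S → InDescendantRange ℓ q.1 q.2 →
      ∀ E ∈ Icc (a + q.1) (b + q.1), (termMatrix0p F D E q.2).PosSemidef) :
    ∀ D, InDimBox lo hi D → ∀ Δ ∈ Ico a b, Pos0p F.toFunctional D Δ ℓ := fun D hD =>
  pos0p_on_cell_Ico F D ha S (fun i q => dboxLo0p F lo hi q.2 (a + q.1) (b + q.1) i)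
    (fun i k q => dboxRad0p F lo hi q.2 (a + q.1) (b + q.1) i k)
    (fun q _ _ hΔ i => dboxLo0p_le F hD q.2 (add_mem_Icc_shift' hΔ q.1) i)
    (fun q _ _ hΔ i k _ => abs_le_dboxRad0p F hD q.2 (add_mem_Icc_shift' hΔ q.1) i k) hvert (htail D hD)

/-- **`0⁺` LIGHT ROWS ON A BOX OF EXTERNAL DIMENSIONS, bound cell** (`a ≥ ℓ + 1`, monotone coefficient
tables `headCellSumM/headAbsSumM`). [cite: KosPolandSimmonsduffin2014, §3.3 eq. (3.16), §4 eqs. (4.2)–(4.3)]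
[cite: HogervorstRychkov2013, §3 eqs. (3.6), (3.9)] [cite: Hladik2017, Thm. 1 ((2) ⇒ (1))]
[cite: ChesterEtAl2020, §3.3 (scanning over external dimensions)] -/
theorem pos0p_on_dbox_boundCell (F : ScanFunctional) {lo hi : Dims} {ℓ : ℕ} {a b : ℝ}
    (ha : (ℓ : ℝ) + 1 ≤ a) (S : Finset (ℕ × ℕ))
    (hvert : ∀ z : Fin 3 → Bool, (signRadMatrix
      (fun i => headCellSumM ℓ a b S (fun q => dboxLo0p F lo hi q.2 (a + q.1) (b + q.1) i))
      (Matrix.of fun i k => headAbsSumM ℓ a b S (fun q => dboxRad0p F lo hi q.2 (a + q.1) (b + q.1) i k))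
        z).PosSemidef)
    (htail : ∀ D, InDimBox lo hi D → ∀ q : ℕ × ℕ, q ∉ S → InDescendantRange ℓ q.1 q.2 →
      ∀ E ∈ Icc (a + q.1) (b + q.1), (termMatrix0p F D E q.2).PosSemidef) :
    ∀ D, InDimBox lo hi D → ∀ Δ ∈ Ico a b, Pos0p F.toFunctional D Δ ℓ := fun D hD =>
  pos0p_on_boundCell_Ico F D ha S (fun i q => dboxLo0p F lo hi q.2 (a + q.1) (b + q.1) i)
    (fun i k q => dboxRad0p F lo hi q.2 (a + q.1) (b + q.1) i k)
    (fun q _ _ hΔ i => dboxLo0p_le F hD q.2 (add_mem_Icc_shift' hΔ q.1) i)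
    (fun q _ _ hΔ i k _ => abs_le_dboxRad0p F hD q.2 (add_mem_Icc_shift' hΔ q.1) i k) hvert (htail D hD)

/-! ## 3. Sector `0⁻` light rows on a box of external dimensions -/

/-- **`0⁻` LIGHT ROWS ON A BOX OF EXTERNAL DIMENSIONS** (cell strictly above the unitarity bound):
`X = headCellSumI(dboxCb0m 0 0) ≥ 0`, `Y = headCellSumI(dboxCb0m 1 1) ≥ 0`, `headAbsSumI(dboxRad0m)² ≤ X Y`,
tail term matrices PSD at every `D` of the box ⇒ `Pos0m` at every `D` of the box and every `Δ ∈ [a, b)`.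
[cite: KosPolandSimmonsduffin2014, §3.3 eq. (3.16), §4 eqs. (4.2)–(4.3)]
[cite: HogervorstRychkov2013, §3 eqs. (3.6), (3.9)] [cite: ChesterEtAl2020, §3.3 (scanning over external dimensions)] -/
theorem pos0m_on_dbox_cell (F : ScanFunctional) {lo hi : Dims} {ℓ : ℕ} {a b : ℝ}
    (ha : unitarityBound3D ℓ < a) (S : Finset (ℕ × ℕ))
    (hX : 0 ≤ headCellSumI ℓ a b S (fun q => dboxCb0m F lo hi q.2 (a + q.1) (b + q.1) 0 0))
    (hY : 0 ≤ headCellSumI ℓ a b S (fun q => dboxCb0m F lo hi q.2 (a + q.1) (b + q.1) 1 1))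
    (hdet : headAbsSumI ℓ a b S (fun q => dboxRad0m F lo hi q.2 (a + q.1) (b + q.1)) ^ 2 ≤
      headCellSumI ℓ a b S (fun q => dboxCb0m F lo hi q.2 (a + q.1) (b + q.1) 0 0) *
        headCellSumI ℓ a b S (fun q => dboxCb0m F lo hi q.2 (a + q.1) (b + q.1) 1 1))
    (htail : ∀ D, InDimBox lo hi D → ∀ q : ℕ × ℕ, q ∉ S → InDescendantRange ℓ q.1 q.2 →
      ∀ E ∈ Icc (a + q.1) (b + q.1), (termMatrix0m F D E q.2).PosSemidef) :
    ∀ D, InDimBox lo hi D → ∀ Δ ∈ Ico a b, Pos0m F.toFunctional D Δ ℓ := fun D hD =>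
  pos0m_on_cell_Ico F D ha S (fun i q => dboxCb0m F lo hi q.2 (a + q.1) (b + q.1) i i)
    (fun q => dboxRad0m F lo hi q.2 (a + q.1) (b + q.1))
    (fun q _ _ hΔ i => dboxCb0m_le F hD q.2 (add_mem_Icc_shift' hΔ q.1) i)
    (fun q _ _ hΔ => abs_le_dboxRad0m F hD q.2 (add_mem_Icc_shift' hΔ q.1)) hX hY hdet (htail D hD)

/-- **`0⁻` LIGHT ROWS ON A BOX OF EXTERNAL DIMENSIONS, bound cell** (`a ≥ ℓ + 1`).
[cite: KosPolandSimmonsduffin2014, §3.3 eq. (3.16), §4 eqs. (4.2)–(4.3)]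
[cite: HogervorstRychkov2013, §3 eqs. (3.6), (3.9)] [cite: ChesterEtAl2020, §3.3 (scanning over external dimensions)] -/
theorem pos0m_on_dbox_boundCell (F : ScanFunctional) {lo hi : Dims} {ℓ : ℕ} {a b : ℝ}
    (ha : (ℓ : ℝ) + 1 ≤ a) (S : Finset (ℕ × ℕ))
    (hX : 0 ≤ headCellSumM ℓ a b S (fun q => dboxCb0m F lo hi q.2 (a + q.1) (b + q.1) 0 0))
    (hY : 0 ≤ headCellSumM ℓ a b S (fun q => dboxCb0m F lo hi q.2 (a + q.1) (b + q.1) 1 1))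
    (hdet : headAbsSumM ℓ a b S (fun q => dboxRad0m F lo hi q.2 (a + q.1) (b + q.1)) ^ 2 ≤
      headCellSumM ℓ a b S (fun q => dboxCb0m F lo hi q.2 (a + q.1) (b + q.1) 0 0) *
        headCellSumM ℓ a b S (fun q => dboxCb0m F lo hi q.2 (a + q.1) (b + q.1) 1 1))
    (htail : ∀ D, InDimBox lo hi D → ∀ q : ℕ × ℕ, q ∉ S → InDescendantRange ℓ q.1 q.2 →
      ∀ E ∈ Icc (a + q.1) (b + q.1), (termMatrix0m F D E q.2).PosSemidef) :
    ∀ D, InDimBox lo hi D → ∀ Δ ∈ Ico a b, Pos0m F.toFunctional D Δ ℓ := fun D hD =>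
  pos0m_on_boundCell_Ico F D ha S (fun i q => dboxCb0m F lo hi q.2 (a + q.1) (b + q.1) i i)
    (fun q => dboxRad0m F lo hi q.2 (a + q.1) (b + q.1))
    (fun q _ _ hΔ i => dboxCb0m_le F hD q.2 (add_mem_Icc_shift' hΔ q.1) i)
    (fun q _ _ hΔ => abs_le_dboxRad0m F hD q.2 (add_mem_Icc_shift' hΔ q.1)) hX hY hdet (htail D hD)

/-! ## 4. Sectors `3`, `2⁻`, `4` light rows on a box of external dimensions -/

/-- The block parameter `(Δ_t − Δ_φ)/2` of the sector-`3` head sums lies in the interval induced by the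
box. [cite: DolanOsborn2004, §3 eq. (3.11)] [cite: ChesterEtAl2020, §3.3 (scanning over external dimensions)] -/
theorem cParam3_mem {lo hi D : Dims} (h : InDimBox lo hi D) :
    (lo.Δt - hi.Δφ) / 2 ≤ (D.Δt - D.Δφ) / 2 ∧ (D.Δt - D.Δφ) / 2 ≤ (hi.Δt - lo.Δφ) / 2 := by
  obtain ⟨-, ⟨hp1, hp2⟩, ⟨ht1, ht2⟩⟩ := h
  constructor <;> linarith

/-- The block parameter `(Δ_t − Δ_s)/2` of the sector-`2⁻` head sums lies in the interval induced by the
box. [cite: DolanOsborn2004, §3 eq. (3.11)] [cite: ChesterEtAl2020, §3.3 (scanning over external dimensions)] -/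
theorem cParam2m_mem {lo hi D : Dims} (h : InDimBox lo hi D) :
    (lo.Δt - hi.Δs) / 2 ≤ (D.Δt - D.Δs) / 2 ∧ (D.Δt - D.Δs) / 2 ≤ (hi.Δt - lo.Δs) / 2 := by
  obtain ⟨⟨hs1, hs2⟩, -, ⟨ht1, ht2⟩⟩ := h
  constructor <;> linarith

/-- **SECTOR-`3` LIGHT ROWS ON A BOX OF EXTERNAL DIMENSIONS** (cell strictly above the unitarity bound,
avoiding `Δ = 1` at `ℓ = 0`): a parameter interval `[c₁, c₂]` containing the box's interval of
`(Δ_t − Δ_φ)/2`, the odd head-cell number of the box corner table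
`cb(c₃, d₃; j, [a+n, b+n], [lo.expo φttφ, hi.expo φttφ])` nonnegative, and the tail terms nonnegative at
every `D` of the box (e.g. `O2ChargedDimBox.dom3Term_nonneg_on_dbox`) ⇒ `Pos3` at every `D` of the box and
every `Δ ∈ [a, b)`. [cite: KosPolandSimmonsduffin2014, §3.3 eq. (3.16), §4 eqs. (4.2)–(4.3)]
[cite: DolanOsborn2004, §3 eqs. (3.11)–(3.12)] [cite: HogervorstRychkov2013, §3 eqs. (3.6), (3.9)]
[cite: ChesterEtAl2020, §3.3 (scanning over external dimensions)] -/
theorem pos3_on_dbox_cell (F : ScanFunctional) {lo hi : Dims} {ℓ : ℕ} {a b c₁ c₂ : ℝ}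
    (ha : unitarityBound3D ℓ < a) (h1 : ℓ = 0 → 1 < a ∨ b ≤ 1) (hc1 : c₁ ≤ (lo.Δt - hi.Δφ) / 2)
    (hc2 : (hi.Δt - lo.Δφ) / 2 ≤ c₂) (S : Finset (ℕ × ℕ))
    (hX : 0 ≤ oddHeadCellSumI ℓ c₁ c₂ a b S (fun q => cornerBound₂ (cWeight3 F) (dWeight3 F) F.z F.zb q.2
      (a + q.1) (b + q.1) (lo.expo .φttφ) (hi.expo .φttφ)))
    (htail : ∀ D, InDimBox lo hi D → ∀ q : ℕ × ℕ, q ∉ S → InDescendantRange ℓ q.1 q.2 →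
      ∀ E ∈ Icc (a + q.1) (b + q.1), 0 ≤ dom3Term F D E q.2) :
    ∀ D, InDimBox lo hi D → ∀ Δ ∈ Ico a b, Pos3 F.toFunctional D Δ ℓ := fun D hD =>
  pos3_on_cell_Ico F D ha h1 (hc1.trans (cParam3_mem hD).1) ((cParam3_mem hD).2.trans hc2) S _
    (fun q _ _ hΔ => by
      rw [dom3Term_eq_twTerm]
      exact (twoWeightEval_mem_Icc_corner_expo F (cWeight3 F) (dWeight3 F) q.2
        (add_mem_Icc_shift' hΔ q.1) hD .φttφ).1)
    hX (htail D hD)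

/-- **SECTOR-`2⁻` LIGHT ROWS ON A BOX OF EXTERNAL DIMENSIONS** (as `pos3_on_dbox_cell`, block parameter
`(Δ_t − Δ_s)/2`, corner table at `[lo.expo stts, hi.expo stts]`).
[cite: KosPolandSimmonsduffin2014, §3.3 eq. (3.16), §4 eqs. (4.2)–(4.3)]
[cite: DolanOsborn2004, §3 eqs. (3.11)–(3.12)] [cite: HogervorstRychkov2013, §3 eqs. (3.6), (3.9)]
[cite: ChesterEtAl2020, §3.3 (scanning over external dimensions)] -/
theorem pos2m_on_dbox_cell (F : ScanFunctional) {lo hi : Dims} {ℓ : ℕ} {a b c₁ c₂ : ℝ}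
    (ha : unitarityBound3D ℓ < a) (h1 : ℓ = 0 → 1 < a ∨ b ≤ 1) (hc1 : c₁ ≤ (lo.Δt - hi.Δs) / 2)
    (hc2 : (hi.Δt - lo.Δs) / 2 ≤ c₂) (S : Finset (ℕ × ℕ))
    (hX : 0 ≤ oddHeadCellSumI ℓ c₁ c₂ a b S (fun q => cornerBound₂ (cWeight2m F) (dWeight2m F) F.z F.zb
      q.2 (a + q.1) (b + q.1) (lo.expo .stts) (hi.expo .stts)))
    (htail : ∀ D, InDimBox lo hi D → ∀ q : ℕ × ℕ, q ∉ S → InDescendantRange ℓ q.1 q.2 →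
      ∀ E ∈ Icc (a + q.1) (b + q.1), 0 ≤ dom2mTerm F D E q.2) :
    ∀ D, InDimBox lo hi D → ∀ Δ ∈ Ico a b, Pos2m F.toFunctional D Δ ℓ := fun D hD =>
  pos2m_on_cell_Ico F D ha h1 (hc1.trans (cParam2m_mem hD).1) ((cParam2m_mem hD).2.trans hc2) S _
    (fun q _ _ hΔ => by
      rw [dom2mTerm_eq_twTerm]
      exact (twoWeightEval_mem_Icc_corner_expo F (cWeight2m F) (dWeight2m F) q.2
        (add_mem_Icc_shift' hΔ q.1) hD .stts).1)
    hX (htail D hD)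

/-- **CHARGE-`4` LIGHT ROWS ON A BOX OF EXTERNAL DIMENSIONS** (cell strictly above the unitarity bound):
head-cell number of the box corner table `cb(c₄, d₄; j, [a+n, b+n], [lo.expo tttt, hi.expo tttt])`
nonnegative and tail terms nonnegative at every `D` of the box (`O2ChargedDimBox.sector4Term_nonneg_on_dbox`)
⇒ `Pos4` at every `D` of the box and every `Δ ∈ [a, b)`.
[cite: KosPolandSimmonsduffin2014, §3.3 eq. (3.16), §4 eqs. (4.2)–(4.3)]
[cite: HogervorstRychkov2013, §3 eqs. (3.6), (3.9)] [cite: ChesterEtAl2020, §3.3 (scanning over external dimensions)] -/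
theorem pos4_on_dbox_cell (F : ScanFunctional) {lo hi : Dims} {ℓ : ℕ} {a b : ℝ}
    (ha : unitarityBound3D ℓ < a) (S : Finset (ℕ × ℕ))
    (hX : 0 ≤ headCellSumI ℓ a b S (fun q => cornerBound₂ (cWeight4 F) (dWeight4 F) F.z F.zb q.2
      (a + q.1) (b + q.1) (lo.expo .tttt) (hi.expo .tttt)))
    (htail : ∀ D, InDimBox lo hi D → ∀ q : ℕ × ℕ, q ∉ S → InDescendantRange ℓ q.1 q.2 →
      ∀ E ∈ Icc (a + q.1) (b + q.1), 0 ≤ sector4Term F D E q.2) :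
    ∀ D, InDimBox lo hi D → ∀ Δ ∈ Ico a b, Pos4 F.toFunctional D Δ ℓ := fun D hD =>
  pos4_on_cell_Ico F D ha S _
    (fun q _ _ hΔ => by
      rw [sector4Term_eq_twoWeightEval]
      exact (twoWeightEval_mem_Icc_corner_expo F (cWeight4 F) (dWeight4 F) q.2
        (add_mem_Icc_shift' hΔ q.1) hD .tttt).1)
    hX (htail D hD)

end Literature.MathematicalPhysics.QuantumFieldTheory.O2LightDimBox

end
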